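import Summits.ABC.IUTFork.Joshi.TestDictionaryCalibrationPlacesDiag
import HarnessLib

/-!
# Branch E TEST vs S — the calibration across places, VI: NO choice of Ism rescues place-separability (two places, `ℚ²` carriers)

Record file of the abc-iut cell, branch E (rung LADDER-ABC:A2.E; seat abc-iut-E-t42 gen 2, row T-42g; sequel of
`Joshi/TestDictionaryCalibrationPlacesDiag.lean` p440540, answering abc-iut-E-t56 g2's audit note I1 of 2026-08-26T11:31:07Z).
**No side is taken** on [IUTchIII] Cor. 3.12 or on any author; typed ≠ proved; interface/toy level; located, not adjudicated.

THE POINT. Part III proved the place obstruction for DIAGONAL strip-automorphisms / Ism and speculated in prose that an Ism MIXING the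
coordinate lines might rescue place-separability. abc-iut-E-t56 g2 (I1) observed that this is implausible: permutations of tensor
factors normalise the factorwise automorphisms, so the PERMUTATION PART of an element of `⟨(Ind1) ∪ (Ind2)⟩` should be well defined —
and it is (Ind1)'s, the same at every place. THIS FILE proves it (no definition of data; two test shapes):
* §1 `IsMonomial Φ σ` := at every packet `Φ_{j,v_ℚ} = permute σ_j * factorwise g` for some factorwise `g` — ONE capsule permutation `σ_j`
  per label for ALL places; **`exists_isMonomial_of_mem_closure`**: every element of `⟨(Ind1) ∪ (Ind2)⟩` is monomial, for EVERY choice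
  of strip-automorphisms `A` and Ism `I` (closure induction over abc-iut-c312's wreath algebra `permute_mul_factorwise`,
  `factorwise_mul`, `permute_mul`, Thm311SigProofs);
* §2 **`eq_one_of_permute_eq_factorwise`** — FAITHFULNESS on `ℚ²` carriers: `permute σ = factorwise g ⟹ σ = 1` (two pure-tensor tests
  `e₁ ⊗ ⋯ ⊗ e₁` and `e₀`-at-one-factor, read through product functionals `prodFun`; a factorwise map cannot move a tensor factor);
* §3 **`not_indPlaceSeparable_anyIsm`**: for EVERY `A`, `I` (containing the identity; no diagonality, no group hypothesis) the
  two-place signature `diagShells A I` is NOT place-separable — part III's `not_indPlaceSeparable_diagShells` without its hypotheses;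
  the prose of p440540's docstring is thereby WITHDRAWN in favour of the stronger kernel statement.
So on two-dimensional carriers at two places NOTHING in the (Ind2) slot rescues place-separability: the excess of the
ONE-indeterminacy forms (X-01 / IndTranslate) over S-as-typed is (Ind1)'s «one permutation of `S^±_{j+1}` for all `v_ℚ`»
([IUTchIII] Thm. 3.11 (i) p. 154; `LogShells.Ind1`), whatever Ism is. [claim: Mochizuki2012, status: disputed]
[claim: Joshi2024ATS3, status: disputed]
-/

noncomputable section

open Set

namespace Summit.ABC.IUTFork.Joshi.TwoPlace

open Thm311 Cor312 Cor312Vol Literature.IUT.LogThetaLattice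

variable (A I : index.V → Set ((Fin 2 → ℚ) ≃ₗ[ℚ] (Fin 2 → ℚ)))
  (hA : ∀ v, LinearEquiv.refl ℚ _ ∈ A v) (hI : ∀ v, LinearEquiv.refl ℚ _ ∈ I v)

/-! ## 1. The monomial form: ONE capsule permutation per label, for all places -/

/-- **`IsMonomial Φ σ`** — at every packet `(j, v_ℚ)`, `Φ_{j,v_ℚ} = permute σ_j * factorwise g` for some family `g` of automorphisms of
the 1-tensor packet: the PERMUTATION PART `σ_j` is the same at every place. TEST SHAPE on automorphism families, never asserted; no
author claims it. [claim: Mochizuki2012, status: disputed] -/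
@[claim "Mochizuki2012" "disputed"]
def IsMonomial (Φ : (diagShells A I hA hI).PacketAut) (σ : ∀ j : index.Label, Equiv.Perm (index.Caps j)) : Prop :=
  ∀ (j : index.Label) (vQ : index.VQ), ∃ g : index.Caps j → ((diagShells A I hA hI).Packet1 vQ ≃ₗ[ℚ] (diagShells A I hA hI).Packet1 vQ),
    Φ j vQ = (diagShells A I hA hI).permute j vQ (σ j) * (diagShells A I hA hI).factorwise j vQ g

variable {A I hA hI}

/-- The identity is monomial along `1`. [folklore] -/
theorem isMonomial_one : IsMonomial A I hA hI 1 1 := fun j vQ =>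
  ⟨1, by rw [(diagShells A I hA hI).factorwise_one, mul_one]; exact ((diagShells A I hA hI).permute_refl j vQ).symm⟩

/-- Products of monomial families are monomial along the product of the permutation parts. [folklore] -/
theorem IsMonomial.mul {Φ Ψ : (diagShells A I hA hI).PacketAut} {σ τ : ∀ j : index.Label, Equiv.Perm (index.Caps j)}
    (hΦ : IsMonomial A I hA hI Φ σ) (hΨ : IsMonomial A I hA hI Ψ τ) : IsMonomial A I hA hI (Φ * Ψ) (σ * τ) := fun j vQ => by
  obtain ⟨g, hg⟩ := hΦ j vQ
  obtain ⟨h, hh⟩ := hΨ j vQ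
  refine ⟨(fun i => g ((τ j) i)) * h, ?_⟩
  rw [Pi.mul_apply, Pi.mul_apply, hg, hh, Pi.mul_apply, (diagShells A I hA hI).permute_mul,
    (diagShells A I hA hI).factorwise_mul, mul_assoc, ← mul_assoc ((diagShells A I hA hI).factorwise j vQ g),
    (diagShells A I hA hI).factorwise_mul_permute, mul_assoc, mul_assoc]

/-- Inverses of monomial families are monomial along the inverse permutation parts. [folklore] -/
theorem IsMonomial.inv {Φ : (diagShells A I hA hI).PacketAut} {σ : ∀ j : index.Label, Equiv.Perm (index.Caps j)}
    (hΦ : IsMonomial A I hA hI Φ σ) : IsMonomial A I hA hI Φ⁻¹ σ⁻¹ := fun j vQ => by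
  obtain ⟨g, hg⟩ := hΦ j vQ
  refine ⟨fun i => g⁻¹ ((σ j)⁻¹ i), ?_⟩
  rw [Pi.inv_apply, Pi.inv_apply, hg, mul_inv_rev, ← (diagShells A I hA hI).factorwise_inv,
    ← (diagShells A I hA hI).permute_inv, (diagShells A I hA hI).factorwise_mul_permute, Pi.inv_apply]

/-- An (Ind2)-family is monomial along `1` (it IS factorwise). [claim: Mochizuki2012, status: disputed] -/
theorem isMonomial_of_mem_Ind2Family {Φ : (diagShells A I hA hI).PacketAut} (hΦ : Φ ∈ (diagShells A I hA hI).Ind2Family) :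
    IsMonomial A I hA hI Φ 1 := fun j vQ => by
  obtain ⟨g, -, hΦj⟩ := hΦ j vQ
  refine ⟨fun i => (diagShells A I hA hI).summandwise vQ (g i), ?_⟩
  rw [hΦj, Pi.one_apply, show (diagShells A I hA hI).permute j vQ (1 : Equiv.Perm (index.Caps j)) = 1 from
    (diagShells A I hA hI).permute_refl j vQ, one_mul]

/-- An (Ind1)-family is monomial along ITS capsule permutations `(σ_j)_j` — one per label for ALL places (the frozen `LogShells.Ind1`:
«ONE permutation `σ` for every `v_ℚ`»). [claim: Mochizuki2012, status: disputed] -/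
theorem exists_isMonomial_of_mem_Ind1Family {Φ : (diagShells A I hA hI).PacketAut} (hΦ : Φ ∈ (diagShells A I hA hI).Ind1Family) :
    ∃ σ, IsMonomial A I hA hI Φ σ := by
  choose σ h hh hΦj using hΦ
  refine ⟨σ, fun j vQ => ⟨fun i => (diagShells A I hA hI).summandwise vQ fun v => h j ((σ j) i) v.1, ?_⟩⟩
  rw [show Φ j vQ = _ from hΦj j vQ, ← LinearEquiv.mul_eq_trans, (diagShells A I hA hI).factorwise_mul_permute]

/-- **`exists_isMonomial_of_mem_closure`** — for EVERY choice of strip-automorphisms and Ism on the `ℚ²` carriers, every element of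
`⟨(Ind1) ∪ (Ind2)⟩` has the monomial form with ONE capsule permutation per label for all places (closure induction).
[claim: Mochizuki2012, status: disputed] -/
theorem exists_isMonomial_of_mem_closure {Φ : (diagShells A I hA hI).PacketAut}
    (hΦ : Φ ∈ Subgroup.closure ((diagShells A I hA hI).Ind1Family ∪ (diagShells A I hA hI).Ind2Family)) :
    ∃ σ, IsMonomial A I hA hI Φ σ := by
  induction hΦ using Subgroup.closure_induction with
  | mem Φ hΦ =>
    rcases hΦ with h1 | h2
    · exact exists_isMonomial_of_mem_Ind1Family h1
    · exact ⟨1, isMonomial_of_mem_Ind2Family h2⟩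
  | one => exact ⟨1, isMonomial_one⟩
  | mul Φ Ψ _ _ ihΦ ihΨ =>
    obtain ⟨σ, hσ⟩ := ihΦ
    obtain ⟨τ, hτ⟩ := ihΨ
    exact ⟨σ * τ, hσ.mul hτ⟩
  | inv Φ _ ih =>
    obtain ⟨σ, hσ⟩ := ih
    exact ⟨σ⁻¹, hσ.inv⟩

/-! ## 2. Faithfulness: a factorwise automorphism cannot move a tensor factor -/

variable (A I hA hI)

/-- The product functional `⊗_k y_k ↦ ∏_k φ_k(y_k)` of a family of linear functionals on the factors. [folklore] -/
def prodFun {j : index.Label} (vQ : index.VQ) (φ : index.Caps j → ((diagShells A I hA hI).Packet1 vQ →ₗ[ℚ] ℚ)) :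
    (diagShells A I hA hI).Packet j vQ →ₗ[ℚ] ℚ :=
  (PiTensorProduct.constantBaseRingEquiv (index.Caps j) ℚ).toLinearEquiv.toLinearMap ∘ₗ PiTensorProduct.map φ

/-- The product functional on a pure tensor. [folklore] -/
theorem prodFun_tprod {j : index.Label} (vQ : index.VQ) (φ : index.Caps j → ((diagShells A I hA hI).Packet1 vQ →ₗ[ℚ] ℚ))
    (x : index.Caps j → (diagShells A I hA hI).Packet1 vQ) :
    prodFun A I hA hI vQ φ ((diagShells A I hA hI).tprod j vQ x) = ∏ k, φ k (x k) := by
  unfold prodFun LogShells.tprod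
  rw [LinearMap.comp_apply]
  erw [PiTensorProduct.map_tprod]
  change (PiTensorProduct.constantBaseRingEquiv (index.Caps j) ℚ) (PiTensorProduct.tprod ℚ fun k : index.Caps j => φ k (x k)) = _
  rw [PiTensorProduct.constantBaseRingEquiv_tprod]

/-- The coordinate-`c` functional of the 1-tensor packet (read at the valuation `pt v_ℚ`). [folklore] -/
def coordFun1 (vQ : index.VQ) (c : Fin 2) : (diagShells A I hA hI).Packet1 vQ →ₗ[ℚ] ℚ :=
  (LinearMap.proj c : (Fin 2 → ℚ) →ₗ[ℚ] ℚ) ∘ₗ (LinearMap.proj (pt vQ) : (diagShells A I hA hI).Packet1 vQ →ₗ[ℚ] (Fin 2 → ℚ))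

/-- Every NONZERO vector of the 1-tensor packet admits a functional taking the value `1` on it. [folklore] -/
theorem exists_functional_eq_one {vQ : index.VQ} {y : (diagShells A I hA hI).Packet1 vQ} (hy : y ≠ 0) :
    ∃ ψ : (diagShells A I hA hI).Packet1 vQ →ₗ[ℚ] ℚ, ψ y = 1 := by
  have hy' : y (pt vQ) ≠ 0 := by
    intro h0
    apply hy
    funext v
    rw [fibre_eq_pt v, h0]
    rfl
  obtain ⟨c, hc⟩ : ∃ c : Fin 2, y (pt vQ) c ≠ 0 := by
    by_contra hall
    apply hy'
    funext c
    exact not_not.1 fun h => hall ⟨c, h⟩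
  refine ⟨(y (pt vQ) c)⁻¹ • coordFun1 A I hA hI vQ c, ?_⟩
  rw [LinearMap.smul_apply, smul_eq_mul]
  exact inv_mul_cancel₀ hc

/-- `factorwise` on a pure tensor. [folklore] -/
theorem factorwise_tprod {j : index.Label} (vQ : index.VQ)
    (g : index.Caps j → ((diagShells A I hA hI).Packet1 vQ ≃ₗ[ℚ] (diagShells A I hA hI).Packet1 vQ))
    (x : index.Caps j → (diagShells A I hA hI).Packet1 vQ) :
    (diagShells A I hA hI).factorwise j vQ g ((diagShells A I hA hI).tprod j vQ x) =
      (diagShells A I hA hI).tprod j vQ fun k => g k (x k) :=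
  PiTensorProduct.congr_tprod g x

/-- `σ({k₀}) = {σ k₀}`. [folklore] -/
theorem permS_singleton {j : index.Label} (σ : Equiv.Perm (index.Caps j)) (k₀ : index.Caps j) :
    permS σ {k₀} = {σ k₀} := by
  ext k
  rw [mem_permS, Finset.mem_singleton, Finset.mem_singleton, Equiv.symm_apply_eq]

/-- `σ(∅) = ∅`. [folklore] -/
theorem permS_empty {j : index.Label} (σ : Equiv.Perm (index.Caps j)) : permS σ (∅ : Finset (index.Caps j)) = ∅ := by
  ext k; simp [mem_permS]

/-- **`eq_one_of_permute_eq_factorwise` — FAITHFULNESS**: on the `ℚ²` carriers a capsule permutation that coincides with a factorwise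
automorphism is the identity. Proof: if `σ k₀ = k₁ ≠ k₀`, test on `e₁ ⊗ ⋯ ⊗ e₁` (fixed by `permute σ`, so `g_{k₁} e₁ ∈ ℚ·e₁` by a product
functional adapted to the `g_k e₁`) and on the pattern `t_{{k₀}}` (moved to `t_{{k₁}}`, whose `k₁`-factor `e₀` the factorwise side
cannot produce). [folklore] -/
theorem eq_one_of_permute_eq_factorwise {j : index.Label} (vQ : index.VQ) {σ : Equiv.Perm (index.Caps j)}
    {g : index.Caps j → ((diagShells A I hA hI).Packet1 vQ ≃ₗ[ℚ] (diagShells A I hA hI).Packet1 vQ)}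
    (h : (diagShells A I hA hI).permute j vQ σ = (diagShells A I hA hI).factorwise j vQ g) : σ = 1 := by
  by_contra hσ
  obtain ⟨k₀, hk₀⟩ : ∃ k₀, σ k₀ ≠ k₀ :=
    not_forall.1 fun hall => hσ (Equiv.ext fun x => (hall x).trans (Equiv.Perm.one_apply x).symm)
  set k₁ := σ k₀ with hk₁
  -- Step A: `g_{k₁} e₁` has vanishing `e₀`-coordinate (test on `t_∅ = e₁ ⊗ ⋯ ⊗ e₁`).
  have hA0 : ∀ k, g k (Ec A I hA hI vQ 1) ≠ 0 := fun k h0 => by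
    have : Ec A I hA hI vQ 1 = 0 := (g k).injective (h0.trans (map_zero _).symm)
    have h1 := congrFun (congrFun this (pt vQ)) 1
    change (Pi.single (1 : Fin 2) (1 : ℚ) : Fin 2 → ℚ) 1 = (0 : ℚ) at h1
    simp at h1
  choose ψ hψ using fun k => exists_functional_eq_one A I hA hI (hA0 k)
  have hempty : (diagShells A I hA hI).tprod j vQ (fun k => g k (Ec A I hA hI vQ 1)) = tS A I hA hI vQ ∅ := by
    have h1 : (diagShells A I hA hI).permute j vQ σ (tS A I hA hI vQ ∅) =
        (diagShells A I hA hI).factorwise j vQ g (tS A I hA hI vQ ∅) := by rw [h]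
    rw [permute_tS, permS_empty] at h1
    calc (diagShells A I hA hI).tprod j vQ (fun k => g k (Ec A I hA hI vQ 1))
        = (diagShells A I hA hI).factorwise j vQ g (tS A I hA hI vQ ∅) := by
          unfold tS; rw [factorwise_tprod]; congr 1
      _ = tS A I hA hI vQ ∅ := h1.symm
  classical
  have hcoord : coordFun1 A I hA hI vQ 0 (g k₁ (Ec A I hA hI vQ 1)) = 0 := by
    let φ : index.Caps j → ((diagShells A I hA hI).Packet1 vQ →ₗ[ℚ] ℚ) :=
      fun k => if k = k₁ then coordFun1 A I hA hI vQ 0 else ψ k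
    have h1 := congrArg (prodFun A I hA hI vQ φ) hempty
    rw [prodFun_tprod, Finset.prod_eq_single k₁ (fun k _ hk => by simp only [φ, if_neg hk]; exact hψ k)
      (fun hk => absurd (Finset.mem_univ k₁) hk)] at h1
    have hφ : φ k₁ = coordFun1 A I hA hI vQ 0 := if_pos rfl
    rw [hφ] at h1
    rw [h1]
    unfold tS
    rw [prodFun_tprod]
    refine Finset.prod_eq_zero (Finset.mem_univ k₁) ?_
    rw [hφ]
    change (xS A I hA hI vQ ∅ k₁) (pt vQ) 0 = 0
    simp [xS, Ec]
  -- Step B: test on the pattern `t_{{k₀}}`: `permute σ` moves its `e₀` to the factor `k₁`, the factorwise side cannot.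
  have hB : detS A I hA hI vQ {k₁} ((diagShells A I hA hI).permute j vQ σ (tS A I hA hI vQ {k₀})) =
      detS A I hA hI vQ {k₁} ((diagShells A I hA hI).factorwise j vQ g (tS A I hA hI vQ {k₀})) := by rw [h]
  rw [permute_tS, permS_singleton, detS_tS_self] at hB
  unfold tS at hB
  rw [factorwise_tprod, detS_tprod, Finset.prod_eq_zero (Finset.mem_univ k₁)] at hB
  · exact one_ne_zero hB
  · have hk : k₁ ∉ ({k₀} : Finset (index.Caps j)) := by
      rw [Finset.mem_singleton]; exact hk₀
    have e1 : xS A I hA hI vQ {k₀} k₁ = Ec A I hA hI vQ 1 := if_neg hk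
    change (g k₁ (xS A I hA hI vQ {k₀} k₁)) (pt vQ) (if k₁ ∈ ({k₁} : Finset (index.Caps j)) then (0 : Fin 2) else 1) = 0
    rw [e1, if_pos (Finset.mem_singleton_self k₁)]
    exact hcoord

/-! ## 3. The place obstruction for EVERY Ism -/

/-- **`not_indPlaceSeparable_anyIsm` — NO CHOICE OF Ism / STRIP-AUTOMORPHISMS RESCUES PLACE-SEPARABILITY** (two places, carriers `ℚ²`;
`A`, `I` arbitrary sets containing the identity): the family «identity at `v_ℚ⁰`, diagonal swap at `v_ℚ¹`» is assembled place by place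
from members of `⟨(Ind1) ∪ (Ind2)⟩` and is not a member — a member is monomial along ONE `σ_{j⋆}` at both places (§1); at `v_ℚ⁰` faithfulness
(§2) forces `σ_{j⋆} = 1`, at `v_ℚ¹` it then forces the swap to be `1`. Supersedes part III's diagonal statement. [claim: Mochizuki2012, status: disputed] -/
theorem not_indPlaceSeparable_anyIsm : ¬ IndPlaceSeparable (diagShells A I hA hI) := fun hsep => by
  have hmem := hsep (fun vQ => placeWitnessD A I hA hI vQ) (placeWitnessD_mem A I hA hI)
  obtain ⟨σ, hσ⟩ := exists_isMonomial_of_mem_closure hmem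
  -- at `v_ℚ⁰`
  obtain ⟨g, hg⟩ := hσ jTop false
  have h0 : (1 : (diagShells A I hA hI).Packet jTop false ≃ₗ[ℚ] (diagShells A I hA hI).Packet jTop false) =
      (diagShells A I hA hI).permute jTop false (σ jTop) * (diagShells A I hA hI).factorwise jTop false g := hg
  have hperm : (diagShells A I hA hI).permute jTop false (σ jTop) = (diagShells A I hA hI).factorwise jTop false g⁻¹ := by
    rw [(diagShells A I hA hI).factorwise_inv]
    exact eq_inv_of_mul_eq_one_left h0.symm
  have hfix : σ jTop = 1 := eq_one_of_permute_eq_factorwise A I hA hI false hperm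
  -- at `v_ℚ¹`
  obtain ⟨g', hg'⟩ := hσ jTop true
  have h1 : (diagShells A I hA hI).permute jTop true (sw jTop) = (diagShells A I hA hI).factorwise jTop true g' := by
    have e : (diagShells A I hA hI).permute jTop true (sw jTop) =
        (diagShells A I hA hI).permute jTop true (σ jTop) * (diagShells A I hA hI).factorwise jTop true g' := hg'
    rw [e, hfix, show (diagShells A I hA hI).permute jTop true (1 : Equiv.Perm (index.Caps jTop)) = 1 from
      (diagShells A I hA hI).permute_refl jTop true, one_mul]
  have hsw : sw jTop = 1 := eq_one_of_permute_eq_factorwise A I hA hI true h1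
  exact sw_jTop_zero_ne (by rw [hsw]; rfl)

/-- In particular (re-deriving part III without its hypotheses): the scalar-sign type Ism = strip-automorphisms = {±1}. [folklore] -/
theorem not_indPlaceSeparable_signShells₂' :
    ¬ IndPlaceSeparable (diagShells (fun _ => {LinearEquiv.refl ℚ _, LinearEquiv.neg ℚ})
      (fun _ => {LinearEquiv.refl ℚ _, LinearEquiv.neg ℚ}) (fun _ => Set.mem_insert _ _) (fun _ => Set.mem_insert _ _)) :=
  not_indPlaceSeparable_anyIsm _ _ _ _

/-- … and the FULL Ism (every linear automorphism of `ℚ²`, strip-automorphisms likewise) — the largest possible (Ind2) slot on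
these carriers does not rescue place-separability either. [folklore] -/
theorem not_indPlaceSeparable_univIsm :
    ¬ IndPlaceSeparable (diagShells (fun _ => Set.univ) (fun _ => Set.univ) (fun _ => Set.mem_univ _) (fun _ => Set.mem_univ _)) :=
  not_indPlaceSeparable_anyIsm _ _ _ _

end Summit.ABC.IUTFork.Joshi.TwoPlace

end
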